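import Summits.CriticalPhenomena.PercolationContinuityZ3.Theorems.PercNearOneGluingNoHeavyLowerTailSahiTwoDimFKG

/-!
# `NoHeavyLowerTail` (crux stmt-CriticalPhenomena-4575), Sahi programme P1: the settled class is closed under sublattices; FKG posets whose
# join-irreducibles are covered by two chains

Support file (Sahi cell, seat `prim-sahi-p1`, generation 2; `--supports stmt-CriticalPhenomena-4575`).  A finite distributive lattice is
*settled* if every FKG probability weight on it is Sahi-positive of every order.

* `sahiPositive_of_latticeEmbedding` — settledness passes along lattice embeddings: if `P` is settled and `e : L → P` is injective and
  preserves `⊓`, `⊔`, then `L` is settled (push forward, `isFKGMeasure_pushWeight`; descend along the monotone retraction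
  `p ↦ ⋁{x : e x ≤ p}`, `SahiCubeAllOrders.sahiPositive_of_pushWeight_of_retract`).  With `SahiOrdinalSum.sahiPositive_sumLex` and
  `sahiPositive_of_orderIso` the settled class is closed under sublattices, ordinal sums and isomorphism.
* `sahiPositive_of_supIrred_twoChains` — an intrinsic form of `SahiTwoDim.sahiPositive_of_latticeEmbedding_prod`: if the join-irreducible
  elements of `L` are covered by two chains `C₁, C₂` (width `≤ 2`, Dilworth), then `L` is settled; the embedding into
  `Fin (|C₁|+1) × Fin (|C₂|+1)` is `x ↦ (#{j ∈ C₁ : j ≤ x}, #{j ∈ C₂ : j ≤ x})` (Birkhoff: `x = ⋁{j ≤ x}`; join-irreducibles are join-prime).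
-/

namespace Summit.CriticalPhenomena.PercolationContinuityZ3.Theorems.SahiSettledClass

open Finset Function Literature.Combinatorics.Sahi2008
open scoped BigOperators

noncomputable section

section Embedding

variable {L P : Type*} [DistribLattice L] [Fintype L] [DistribLattice P] [Fintype P]

/-- **Settledness passes to sublattices.**  If every FKG probability weight on `P` is Sahi-positive of every order and
`e : L → P` is injective and preserves `⊓` and `⊔`, then every FKG probability weight on `L` is Sahi-positive of every order.
[this work] -/
theorem sahiPositive_of_latticeEmbedding (e : L → P) (he : Function.Injective e)
    (hinf : ∀ x y, e (x ⊓ y) = e x ⊓ e y) (hsup : ∀ x y, e (x ⊔ y) = e x ⊔ e y)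
    (hP : ∀ ν : P → ℝ, IsFKGMeasure ν → ∀ n, SahiPositive ν n) {μ : L → ℝ} (hμ : IsFKGMeasure μ) (n : ℕ) :
    SahiPositive μ n := by
  classical
  have hL : Nonempty L := by
    by_contra h
    rw [not_nonempty_iff] at h
    exact one_ne_zero (hμ.sum_eq_one.symm.trans (Fintype.sum_empty _))
  letI : OrderBot L := Fintype.toOrderBot L
  have hle : ∀ x y, e x ≤ e y ↔ x ≤ y := by
    intro x y
    constructor
    · intro h
      have h1 : e (x ⊓ y) = e x := by rw [hinf]; exact inf_eq_left.2 h
      exact inf_eq_left.1 (he h1)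
    · intro h
      have h1 : e x ⊓ e y = e x := by rw [← hinf, inf_eq_left.2 h]
      exact inf_eq_left.1 h1
  obtain ⟨R, hR⟩ : ∃ R : P → L, ∀ p, R p = (univ.filter fun x => e x ≤ p).sup id := ⟨_, fun p => rfl⟩
  have hRmono : Monotone R := by
    intro p p' hpp'
    rw [hR, hR]
    refine Finset.sup_mono fun x hx => ?_
    rw [mem_filter] at hx ⊢
    exact ⟨hx.1, hx.2.trans hpp'⟩
  have hRE : ∀ x, R (e x) = x := by
    intro x
    rw [hR]
    refine le_antisymm (Finset.sup_le fun y hy => ?_) ?_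
    · rw [mem_filter] at hy
      exact (hle y x).1 hy.2
    · exact Finset.le_sup (f := id) (by rw [mem_filter]; exact ⟨mem_univ _, le_rfl⟩)
  exact SahiCubeAllOrders.sahiPositive_of_pushWeight_of_retract hRmono hRE
    (hP _ (isFKGMeasure_pushWeight hμ he hinf hsup) n)

end Embedding

/-! ## Join-irreducibles covered by two chains -/

section TwoChains

variable {L : Type*} [DistribLattice L] [Fintype L] [DecidableEq L]

omit [Fintype L] [DecidableEq L] in
/-- Two lower sets of a finite chain are nested (plumbing). [folklore] -/
theorem lowerSet_chain_nested {C : Finset L} (hC : IsChain (· ≤ ·) (C : Set L)) {D₁ D₂ : Finset L} (h₁ : D₁ ⊆ C)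
    (h₂ : D₂ ⊆ C) (hD₁ : ∀ ⦃a b⦄, b ∈ D₁ → a ∈ C → a ≤ b → a ∈ D₁) (hD₂ : ∀ ⦃a b⦄, b ∈ D₂ → a ∈ C → a ≤ b → a ∈ D₂) :
    D₁ ⊆ D₂ ∨ D₂ ⊆ D₁ := by
  by_contra hcon
  rw [not_or] at hcon
  obtain ⟨x, hx₁, hx₂⟩ := not_subset.1 hcon.1
  obtain ⟨y, hy₂, hy₁⟩ := not_subset.1 hcon.2
  have hxy : x ≠ y := by rintro rfl; exact hx₂ hy₂
  rcases hC (h₁ hx₁) (h₂ hy₂) hxy with hle | hle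
  · exact hx₂ (hD₂ hy₂ (h₁ hx₁) hle)
  · exact hy₁ (hD₁ hx₁ (h₂ hy₂) hle)

/-- **Join-irreducibles covered by two chains ⇒ settled.**  If the join-irreducible (`SupIrred`) elements of a finite distributive
lattice `L` are contained in the union of two chains `C₁, C₂`, then every FKG probability weight on `L` is Sahi-positive of every
order.  The lattice embedding into `Fin (C₁.card + 1) × Fin (C₂.card + 1)` is `x ↦ (#{j ∈ C₁ : j ≤ x}, #{j ∈ C₂ : j ≤ x})`;
then `SahiTwoDim.sahiPositive_of_latticeEmbedding_prod`. [this work] -/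
theorem sahiPositive_of_supIrred_twoChains (C₁ C₂ : Finset L) (hC₁ : IsChain (· ≤ ·) (C₁ : Set L))
    (hC₂ : IsChain (· ≤ ·) (C₂ : Set L)) (hirr₁ : ∀ j ∈ C₁, SupIrred j) (hirr₂ : ∀ j ∈ C₂, SupIrred j)
    (hcover : ∀ j : L, SupIrred j → j ∈ C₁ ∨ j ∈ C₂) {μ : L → ℝ} (hμ : IsFKGMeasure μ) (n : ℕ) :
    SahiPositive μ n := by
  classical
  have hL : Nonempty L := by
    by_contra h
    rw [not_nonempty_iff] at h
    exact one_ne_zero (hμ.sum_eq_one.symm.trans (Fintype.sum_empty _))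
  letI : OrderBot L := Fintype.toOrderBot L
  -- the down-part of a chain below `x`
  have hcard : ∀ (C : Finset L) (x : L), (C.filter fun j => j ≤ x).card < C.card + 1 := fun C x =>
    Nat.lt_succ_of_le (card_le_card (filter_subset _ _))
  obtain ⟨e, he⟩ : ∃ e : L → Fin (C₁.card + 1) × Fin (C₂.card + 1), ∀ x,
      e x = (⟨(C₁.filter fun j => j ≤ x).card, hcard C₁ x⟩, ⟨(C₂.filter fun j => j ≤ x).card, hcard C₂ x⟩) :=
    ⟨_, fun x => rfl⟩
  -- down-parts are nested, so cardinalities determine them and behave like min / max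
  have hdown : ∀ (C : Finset L), IsChain (· ≤ ·) (C : Set L) → ∀ x y : L,
      (C.filter fun j => j ≤ x) ⊆ (C.filter fun j => j ≤ y) ∨ (C.filter fun j => j ≤ y) ⊆ (C.filter fun j => j ≤ x) := by
    intro C hC x y
    refine lowerSet_chain_nested hC (filter_subset _ _) (filter_subset _ _) ?_ ?_
    · intro a b hb ha hab
      rw [mem_filter] at hb ⊢
      exact ⟨ha, hab.trans hb.2⟩
    · intro a b hb ha hab
      rw [mem_filter] at hb ⊢
      exact ⟨ha, hab.trans hb.2⟩
  have hinfC : ∀ (C : Finset L), IsChain (· ≤ ·) (C : Set L) → ∀ x y : L,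
      (C.filter fun j => j ≤ x ⊓ y).card = min (C.filter fun j => j ≤ x).card (C.filter fun j => j ≤ y).card := by
    intro C hC x y
    have hxy : (C.filter fun j => j ≤ x ⊓ y) = (C.filter fun j => j ≤ x) ∩ (C.filter fun j => j ≤ y) := by
      ext j; simp only [mem_filter, mem_inter, le_inf_iff]; tauto
    rw [hxy]
    rcases hdown C hC x y with h | h
    · rw [inter_eq_left.2 h, min_eq_left (card_le_card h)]
    · rw [inter_eq_right.2 h, min_eq_right (card_le_card h)]
  have hsupC : ∀ (C : Finset L), IsChain (· ≤ ·) (C : Set L) → (∀ j ∈ C, SupIrred j) → ∀ x y : L,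
      (C.filter fun j => j ≤ x ⊔ y).card = max (C.filter fun j => j ≤ x).card (C.filter fun j => j ≤ y).card := by
    intro C hC hirr x y
    have hxy : (C.filter fun j => j ≤ x ⊔ y) = (C.filter fun j => j ≤ x) ∪ (C.filter fun j => j ≤ y) := by
      ext j
      simp only [mem_filter, mem_union]
      constructor
      · rintro ⟨hj, hle⟩
        rcases (hirr j hj).supPrime.le_sup.1 hle with h | h
        · exact Or.inl ⟨hj, h⟩
        · exact Or.inr ⟨hj, h⟩
      · rintro (⟨hj, h⟩ | ⟨hj, h⟩)
        · exact ⟨hj, h.trans le_sup_left⟩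
        · exact ⟨hj, h.trans le_sup_right⟩
    rw [hxy]
    rcases hdown C hC x y with h | h
    · rw [union_eq_right.2 h, max_eq_right (card_le_card h)]
    · rw [union_eq_left.2 h, max_eq_left (card_le_card h)]
  -- every element is the join of the join-irreducibles below it, all of which lie in `C₁ ∪ C₂`
  have hrecover : ∀ x : L, x = ((C₁ ∪ C₂).filter fun j => j ≤ x).sup id := by
    intro x
    refine le_antisymm ?_ (Finset.sup_le fun j hj => (mem_filter.1 hj).2)
    obtain ⟨s, hs, hirr⟩ := exists_supIrred_decomposition x
    conv_lhs => rw [← hs]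
    refine Finset.sup_le fun b hb => ?_
    have hbx : b ≤ x := by rw [← hs]; exact Finset.le_sup (f := id) hb
    have hbC : b ∈ C₁ ∪ C₂ := mem_union.2 (hcover b (hirr hb))
    exact Finset.le_sup (f := id) (mem_filter.2 ⟨hbC, hbx⟩)
  have hinj : Function.Injective e := by
    intro x y hxy
    rw [he, he, Prod.mk.injEq, Fin.mk.injEq, Fin.mk.injEq] at hxy
    have h1 : (C₁.filter fun j => j ≤ x) = (C₁.filter fun j => j ≤ y) := by
      rcases hdown C₁ hC₁ x y with h | h
      · exact eq_of_subset_of_card_le h hxy.1.symm.le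
      · exact (eq_of_subset_of_card_le h hxy.1.le).symm
    have h2 : (C₂.filter fun j => j ≤ x) = (C₂.filter fun j => j ≤ y) := by
      rcases hdown C₂ hC₂ x y with h | h
      · exact eq_of_subset_of_card_le h hxy.2.symm.le
      · exact (eq_of_subset_of_card_le h hxy.2.le).symm
    have h12 : ((C₁ ∪ C₂).filter fun j => j ≤ x) = ((C₁ ∪ C₂).filter fun j => j ≤ y) := by
      rw [filter_union, filter_union, h1, h2]
    rw [hrecover x, hrecover y, h12]
  have hinf : ∀ x y, e (x ⊓ y) = e x ⊓ e y := by
    intro x y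
    rw [he, he, he, Prod.inf_def]
    refine Prod.ext (Fin.ext ?_) (Fin.ext ?_)
    · show (C₁.filter fun j => j ≤ x ⊓ y).card = ((min ⟨(C₁.filter fun j => j ≤ x).card, hcard C₁ x⟩
        ⟨(C₁.filter fun j => j ≤ y).card, hcard C₁ y⟩ : Fin (C₁.card + 1)) : ℕ)
      rw [Fin.coe_min, hinfC C₁ hC₁]
    · show (C₂.filter fun j => j ≤ x ⊓ y).card = ((min ⟨(C₂.filter fun j => j ≤ x).card, hcard C₂ x⟩
        ⟨(C₂.filter fun j => j ≤ y).card, hcard C₂ y⟩ : Fin (C₂.card + 1)) : ℕ)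
      rw [Fin.coe_min, hinfC C₂ hC₂]
  have hsup : ∀ x y, e (x ⊔ y) = e x ⊔ e y := by
    intro x y
    rw [he, he, he, Prod.sup_def]
    refine Prod.ext (Fin.ext ?_) (Fin.ext ?_)
    · show (C₁.filter fun j => j ≤ x ⊔ y).card = ((max ⟨(C₁.filter fun j => j ≤ x).card, hcard C₁ x⟩
        ⟨(C₁.filter fun j => j ≤ y).card, hcard C₁ y⟩ : Fin (C₁.card + 1)) : ℕ)
      rw [Fin.coe_max, hsupC C₁ hC₁ hirr₁]
    · show (C₂.filter fun j => j ≤ x ⊔ y).card = ((max ⟨(C₂.filter fun j => j ≤ x).card, hcard C₂ x⟩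
        ⟨(C₂.filter fun j => j ≤ y).card, hcard C₂ y⟩ : Fin (C₂.card + 1)) : ℕ)
      rw [Fin.coe_max, hsupC C₂ hC₂ hirr₂]
  exact SahiTwoDim.sahiPositive_of_latticeEmbedding_prod e hinj hinf hsup hμ n

end TwoChains

end

end Summit.CriticalPhenomena.PercolationContinuityZ3.Theorems.SahiSettledClass
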